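import Summits.QuantumAdvantage.QuantumAdvantage.Theses.DarkClassGroups
import Literature.Computability.Cryptography.HallgrenClassGroup
import Literature.Computability.Cryptography.HallgrenClassGroupDiscriminant
import Literature.NumberTheory.QuadraticFields.ImaginaryResidueClassNumber
import Literature.NumberTheory.LFunctions.SiegelTheorem
import HarnessLib.Audit

/-!
# Line `no-siegel-bright` — piece P1 `NoSiegelBright` of the BC2 redirect of
# `DarkClassGroups.ClassNumberFBQP` (stmt-QuantumAdvantage-11623) — skeleton v1

Planner `planner-cstrat-stmt-QuantumAdvantage-11623-r1-0` (crux-strategist, RESTATED re-audit, 2026-08-17).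

THE PIECE (verbatim the child statement filed with `route edit --split`; until the split is materialised the
decl below is a byte-identical local stand-in, afterwards `NoSiegelBright_of` is retargeted to
`Summit.QuantumAdvantage.QuantumAdvantage.Theses.DarkClassGroups.NoSiegelBright` by changing one type ascription):
under `NoSiegelZerosOddQuadratic` (∃ c > 0, no real zero of `L(s, χ)` in `σ > 1 − c/log q` for odd real
primitive `χ` mod `q ≥ 3`) every negative fundamental discriminant `−d` is BRIGHT: `√d ≤ C·h(−d)·log d` for one
absolute `C : ℕ` (`h` = the tree's form-count `BinaryQuadraticForm.classNumber`).  This is exactly the place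
where every printed quantum class-group algorithm uses GRH (Hallgren 2005 / Childs–van Dam 2010 §5.7 via Bach's
bound; in the tree: `Hallgren2005.sqrt_le_classNumber_mul_log_of_grandRiemannHypothesisGL`, the ONE use of GRH in
the `Hallgren2005_classNumber_qsolvable_of_GRH` programme).

THE LINE (effective Hecke–Landau, three stubs, template = the LANDED
`Theorems/ArithStatLadderIqThreeMemBQPStubMirrorDichotomy.lean`, which runs the same argument for a PAIR of
characters with Landau's repulsion in place of hypothesis (i)):
* S1 `stub_oddPrimitiveKronecker` [M] — for `−d` fundamental and `K` quadratic of discriminant `−d`: a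
  primitive quadratic ODD Dirichlet character `κ ≠ 1` mod `d` with `Re L(1, κ) = κ_K` (residue of `ζ_K`):
  `Quadratic.exists_kroneckerChar` + `isPrimitive_jacobiChar` / `isPrimitive_of_forall_odd` +
  `Quadratic.LFunction_one_eq_dedekindZeta_residue_of_eq` (all tree) + oddness (`κ(−1) = sign d_K`).
* S2 `stub_residue_lower_of_zeroFree` [M] — MV Thm 11.14 Case A with `η = min(1/4, c/(2 log d))`:
  `Siegel.caseA` gives `Re L(1, κ) ≥ c_E η (B d)^{−A_E η} ≥ c'/log d` (bookkeeping verbatim as `hlow` in the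
  mirror-dichotomy file).
* S3 `stub_bright_classNumber_of_residue` [S–M] — residue brightness ⇒ class-number brightness:
  `Quadratic.le_classNumber_of_dedekindZeta_residue_ge` (`c√d/(π log d) ≤ h_K`), `IsNegFundamentalDiscr.classNumber_eq`,
  `exists_numberField`, `C = ⌈π/c'⌉₊` (and `log d ≥ log 3 > 0`).
COMPOSITION `NoSiegelBright_of` (kernel-checked, sorry-free): (i) gives `c`; S2 gives `c'`; S3 gives `C`; for a
fundamental `d` and any `K` of discriminant `−d`, S1's `κ` is odd/primitive/quadratic mod `d ≥ 3`, so (i) makes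
`L(s, κ)` zero-free on `σ > 1 − c/log d`, S2 bounds `Re L(1, κ) = κ_K`, i.e. `K` is `c'`-bright, and S3 concludes.

HONEST LABEL. No stub restates the piece, the crux or the summit: S1 is character bookkeeping, S2 is a statement
about ONE Dirichlet character with a GIVEN zero-free region (no hypothesis (i) inside), S3 is the class number
formula. Disproof.lean: none exists for this crux (`ledger crux ls stmt-QuantumAdvantage-11623`: no workfiles);
`ledger negatives --problem QuantumAdvantage` (6 entries: RegulatorThird, ShorLocallyDark, CubicForrelation,
SpinorFlattening, KummerSector, SeparableFrames) — unrelated, no stub is an instance.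
-/

noncomputable section

set_option linter.dupNamespace false

namespace Summit.QuantumAdvantage.QuantumAdvantage.Cruxes.NoSiegelBright.Birth

open Literature.Computability.Cryptography (IsNegFundamentalDiscr)
open Literature.NumberTheory.QuadraticFields (BinaryQuadraticForm.classNumber)

/-- THE PIECE (byte-identical stand-in for the route decl `DarkClassGroups.NoSiegelBright`). -/
def NoSiegelBright : Prop :=
  Summit.RiemannHypothesis.RiemannHypothesis.NoSiegelZerosOddQuadratic → ∃ C : ℕ, ∀ d : ℕ, (((-(d : ℤ)) % 4 = 1 ∧ Squarefree (-(d : ℤ)) ∧ (-(d : ℤ)) ≠ 1) ∨ (4 ∣ (-(d : ℤ)) ∧ ((-(d : ℤ)) / 4 % 4 = 2 ∨ (-(d : ℤ)) / 4 % 4 = 3) ∧ Squarefree ((-(d : ℤ)) / 4))) → Real.sqrt (d : ℝ) ≤ (C : ℝ) * (Literature.NumberTheory.QuadraticFields.BinaryQuadraticForm.classNumber (-(d : ℤ)) : ℝ) * Real.log (d : ℝ)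

/-! ## Registered stubs — `sorry` lives ONLY in these three theorems -/

/-- Stub S1 `stub_oddPrimitiveKronecker` [M]: the odd primitive quadratic Kronecker character of an
imaginary quadratic field, with `Re L(1, κ) = κ_K`. -/
theorem stub_oddPrimitiveKronecker : ∀ (d : ℕ) [NeZero d], Literature.Computability.Cryptography.IsNegFundamentalDiscr d →
    ∀ (K : Type) [Field K] [NumberField K], Module.finrank ℚ K = 2 → NumberField.discr K = -(d : ℤ) →
      ∃ κ : DirichletCharacter ℂ d, κ ≠ 1 ∧ κ.IsQuadratic ∧ κ.IsPrimitive ∧ κ.Odd ∧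
        (κ.LFunction 1).re = NumberField.dedekindZeta_residue K := by
  sorry

/-- Stub S2 `stub_residue_lower_of_zeroFree` [M]: a zero-free interval `(1 − c/log d, 1)` for a real
non-principal character mod `d ≥ 3` forces `Re L(1, κ) ≥ c'/log d` (MV Thm 11.14 Case A, `Siegel.caseA`). -/
theorem stub_residue_lower_of_zeroFree : ∀ c : ℝ, 0 < c → ∃ c' : ℝ, 0 < c' ∧
    ∀ (d : ℕ) [NeZero d], 3 ≤ d → ∀ κ : DirichletCharacter ℂ d, κ ≠ 1 → κ ^ 2 = 1 →
      (∀ σ : ℝ, 1 - c / Real.log d < σ → κ.LFunction σ ≠ 0) → c' / Real.log d ≤ (κ.LFunction 1).re := by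
  sorry

/-- Stub S3 `stub_bright_classNumber_of_residue` [S–M]: residue brightness of every quadratic field of
discriminant `−d` gives class-number brightness `√d ≤ C·h(−d)·log d` with `C` depending on `c` only. -/
theorem stub_bright_classNumber_of_residue : ∀ c : ℝ, 0 < c → ∃ C : ℕ, ∀ d : ℕ,
    Literature.Computability.Cryptography.IsNegFundamentalDiscr d →
    (∀ (K : Type) [Field K] [NumberField K], Module.finrank ℚ K = 2 → NumberField.discr K = -(d : ℤ) →
      c / Real.log d ≤ NumberField.dedekindZeta_residue K) →
    Real.sqrt (d : ℝ) ≤ (C : ℝ) * (Literature.NumberTheory.QuadraticFields.BinaryQuadraticForm.classNumber (-(d : ℤ)) : ℝ) * Real.log (d : ℝ) := by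
  sorry

/-! ### Name-keyed aliases of the stub STATEMENTS (hypotheses of the composition) -/
namespace Registered

/-- Statement of S1. -/
abbrev stub_oddPrimitiveKronecker : Prop := ∀ (d : ℕ) [NeZero d], Literature.Computability.Cryptography.IsNegFundamentalDiscr d →
    ∀ (K : Type) [Field K] [NumberField K], Module.finrank ℚ K = 2 → NumberField.discr K = -(d : ℤ) →
      ∃ κ : DirichletCharacter ℂ d, κ ≠ 1 ∧ κ.IsQuadratic ∧ κ.IsPrimitive ∧ κ.Odd ∧
        (κ.LFunction 1).re = NumberField.dedekindZeta_residue K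
/-- Statement of S2. -/
abbrev stub_residue_lower_of_zeroFree : Prop := ∀ c : ℝ, 0 < c → ∃ c' : ℝ, 0 < c' ∧
    ∀ (d : ℕ) [NeZero d], 3 ≤ d → ∀ κ : DirichletCharacter ℂ d, κ ≠ 1 → κ ^ 2 = 1 →
      (∀ σ : ℝ, 1 - c / Real.log d < σ → κ.LFunction σ ≠ 0) → c' / Real.log d ≤ (κ.LFunction 1).re
/-- Statement of S3. -/
abbrev stub_bright_classNumber_of_residue : Prop := ∀ c : ℝ, 0 < c → ∃ C : ℕ, ∀ d : ℕ,
    Literature.Computability.Cryptography.IsNegFundamentalDiscr d →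
    (∀ (K : Type) [Field K] [NumberField K], Module.finrank ℚ K = 2 → NumberField.discr K = -(d : ℤ) →
      c / Real.log d ≤ NumberField.dedekindZeta_residue K) →
    Real.sqrt (d : ℝ) ≤ (C : ℝ) * (Literature.NumberTheory.QuadraticFields.BinaryQuadraticForm.classNumber (-(d : ℤ)) : ℝ) * Real.log (d : ℝ)

end Registered

/-! ## The composition (kernel-checked; no `sorry` below) -/

/-- **`NoSiegelBright_of`**: hypothesis (i) ⇒ zero-free interval for the odd primitive Kronecker character
(S1) ⇒ residue lower bound (S2) ⇒ class-number brightness (S3). -/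
theorem NoSiegelBright_of (h1 : Registered.stub_oddPrimitiveKronecker)
    (h2 : Registered.stub_residue_lower_of_zeroFree)
    (h3 : Registered.stub_bright_classNumber_of_residue) : NoSiegelBright := by
  intro hNSZ
  obtain ⟨c, hc, hzf⟩ := hNSZ
  obtain ⟨c', hc', hlow⟩ := h2 c hc
  obtain ⟨C, hC⟩ := h3 c' hc'
  refine ⟨C, fun d hd => hC d hd ?_⟩
  intro K _ _ h2K hdisc
  have hd' : Literature.Computability.Cryptography.IsNegFundamentalDiscr d := hd
  haveI : NeZero d := ⟨hd'.ne_zero⟩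
  obtain ⟨κ, hκ1, hκq, hκp, hκo, hκres⟩ := h1 d hd' K h2K hdisc
  have hz : ∀ σ : ℝ, 1 - c / Real.log d < σ → κ.LFunction σ ≠ 0 :=
    fun σ hσ => hzf d hd'.three_le κ hκq hκp hκo σ hσ
  rw [← hκres]
  exact hlow d hd'.three_le κ hκ1 hκq.sq_eq_one hz

/-- Wiring check: the registered stubs feed the composition as stated. -/
example : NoSiegelBright :=
  NoSiegelBright_of (fun d _ => stub_oddPrimitiveKronecker d) stub_residue_lower_of_zeroFree
    stub_bright_classNumber_of_residue

end Summit.QuantumAdvantage.QuantumAdvantage.Cruxes.NoSiegelBright.Birth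

end
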